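import Summits.RiemannHypothesis.RiemannHypothesis.Theorems.PfPersistenceF5PairMargin
import HarnessLib

/-!
# PF persistence, fake seat 5 — signed COMBS of translates on a Weil-positive window (F5-COMB, PSD half)

Unit `pub-rhpf-fake-5` (gen 5) of the `pub-rhpf` cell — mechanism / rigidity campaign; **no RH claims**.
(FAKES.md §5.8 ADDENDUM 2, THEOREM F5-COMB; GAP-CLASSES row F5-SWAP-G.)

THEOREM F5-PAIR (`PfPersistenceF5SignedTwins`) detects a signed two-site re-weighting of `ζ`'s table
beyond a cutoff with a single TWIN `g₁(u + c) − σ g₁(u − c)`, at depth `max |cᵢ|·D` with the pair margin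
`D < ‖g₁‖²`.  The window DATA of FAKES §5.8 (kit jobs j075458 / j075669) show that the bottom
eigenvector does better: it harvests (asymptotically all of) the `ℓ¹` mass `Σ|c_n|`, by a COMB
`g = Σ_j ε_j g₁(· − x_j)` of `m` signed translates whose difference set meets each site lag `log n`
exactly once, with the sign of `c_n`.  THEOREM F5-COMB = (prime side) such a stray-free comb picks up
exactly `−2 Σ_n |c_n| ‖g₁‖²` from the perturbation + (PSD side) on a Weil-positive window `Re Q_ζ` of
ANY signed comb of `m` translates of `g₁` is at most `K(m)·Re Q_ζ(g₁)`-sized.  This file proves the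
PSD side, which is the half that uses `WeilPositivityOn`:

* `re_weilQuadratic_add_real_mul_le` — `Re Q(u + t v) ≤ 2 Re Q(u) + 2 t² Re Q(v)` for tests `u, v`
  supported in a Weil-positive window (`0 ≤ Re Q(u − t v)` and the polarisation identity
  `ConnesVanSuijlekom.re_weilQuadratic_add_real_mul`);
* `comb`, `isWeilTest_comb`, `tsupport_comb_subset` — finite signed combs of translates are test
  functions supported in `[-a, a]` when `|x_j| + b ≤ a`;
* `re_weilQuadratic_comb_le` — for `|ε_j| ≤ 1`, `Re Q_ζ(comb) ≤ (2^{m+1} − 2)·E` whenever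
  `Re Q_ζ(g₁) ≤ E` and `ζ` is Weil-positive on `[-a, a]` (induction on `m`; translation invariance
  `weilQuadratic_translate`).  The constant is crude (convexity would give `m²`) and irrelevant for the
  campaign: the `E = ε‖g₁‖²` it multiplies is the near-extremal Rayleigh quotient of `ζ`, astronomically
  small in the served windows (DATA), so any explicit `K(m)` yields the same hairline conclusion.

All statements are RH-free and weight-free.  References: A. Weil 1952 (positivity criterion);
E. Bombieri, Rend. Mat. Acc. Lincei (9) 11 (2000) §3–4 (the hermitian form `T[f * f̃]`).
-/

set_option linter.dupNamespace false  -- the mandated namespace repeats `RiemannHypothesis`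

noncomputable section

open scoped ArithmeticFunction
open Set MeasureTheory Complex Literature.NumberTheory.LFunctions
open Summit.RiemannHypothesis.RiemannHypothesis.Theorems.PfPersistenceF5TailTwins (tsupport_add_mul_subset)

namespace Summit.RiemannHypothesis.RiemannHypothesis.Theorems.PfPersistenceF5CombPSD

variable {g u v : ℝ → ℂ} {a b : ℝ}

/-! ## §1 Two terms: the PSD parallelogram inequality -/

/-- **PSD parallelogram inequality.** If `u, v` are Weil tests supported in `[-a, a]` and `ζ` is
Weil-positive on `[-a, a]`, then `Re Q(u + t v) ≤ 2 Re Q(u) + 2t² Re Q(v)` for every real `t`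
(add the polarisation identities at `t` and `-t` and drop `Re Q(u - t v) ≥ 0`). [folklore] -/
theorem re_weilQuadratic_add_real_mul_le (hu : IsWeilTest u) (hv : IsWeilTest v)
    (hus : tsupport u ⊆ Icc (-a) a) (hvs : tsupport v ⊆ Icc (-a) a) (hW : WeilPositivityOn a)
    (t : ℝ) :
    (weilQuadratic (u + fun x ↦ (t : ℂ) * v x)).re ≤
      2 * (weilQuadratic u).re + 2 * (t ^ 2 * (weilQuadratic v).re) := by
  have h1 := ConnesVanSuijlekom.re_weilQuadratic_add_real_mul hu hv t
  have h2 := ConnesVanSuijlekom.re_weilQuadratic_add_real_mul hu hv (-t)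
  have hpos : 0 ≤ (weilQuadratic (u + fun x ↦ ((-t : ℝ) : ℂ) * v x)).re :=
    hW _ (hu.add (hv.const_mul _)) (tsupport_add_mul_subset isClosed_Icc hus hvs _)
  rw [h2] at hpos
  rw [h1]
  nlinarith [hpos]

/-- The special case `t = 1`: `Re Q(u + v) ≤ 2 Re Q(u) + 2 Re Q(v)`. [folklore] -/
theorem re_weilQuadratic_add_le (hu : IsWeilTest u) (hv : IsWeilTest v)
    (hus : tsupport u ⊆ Icc (-a) a) (hvs : tsupport v ⊆ Icc (-a) a) (hW : WeilPositivityOn a) :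
    (weilQuadratic (u + v)).re ≤ 2 * (weilQuadratic u).re + 2 * (weilQuadratic v).re := by
  have h := re_weilQuadratic_add_real_mul_le hu hv hus hvs hW 1
  have huv : (u + fun x ↦ ((1 : ℝ) : ℂ) * v x) = u + v := by
    funext x; simp
  rw [huv] at h
  simpa using h

/-! ## §2 Signed combs of translates -/

/-- The signed COMB `Σ_{j < m} ε_j · g(· − x_j)` of `m` translates of `g`. -/
def comb (m : ℕ) (x ε : Fin m → ℝ) (g : ℝ → ℂ) : ℝ → ℂ :=
  fun t ↦ ∑ j, ((ε j : ℝ) : ℂ) * g (t - x j)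

/-- The empty comb is `0`. -/
theorem comb_zero (x ε : Fin 0 → ℝ) (g : ℝ → ℂ) : comb 0 x ε g = 0 := by
  funext t; simp [comb]

/-- Peeling off the last tooth: `comb_{m+1} = comb_m + ε_m · τ_{x_m} g`. -/
theorem comb_succ (m : ℕ) (x ε : Fin (m + 1) → ℝ) (g : ℝ → ℂ) :
    comb (m + 1) x ε g = comb m (fun j ↦ x (Fin.castSucc j)) (fun j ↦ ε (Fin.castSucc j)) g +
      fun t ↦ ((ε (Fin.last m) : ℝ) : ℂ) * PfPersistenceF5TailTwins.translate (x (Fin.last m)) g t := by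
  funext t
  simp only [comb, Pi.add_apply, PfPersistenceF5TailTwins.translate, Fin.sum_univ_castSucc]

/-- A signed comb of translates of a Weil test function is a Weil test function. -/
theorem isWeilTest_comb (hg : IsWeilTest g) :
    ∀ (m : ℕ) (x ε : Fin m → ℝ), IsWeilTest (comb m x ε g) := by
  intro m
  induction m with
  | zero => intro x ε; rw [comb_zero]; exact isWeilTest_zero
  | succ m ih =>
    intro x ε
    rw [comb_succ]
    exact (ih _ _).add ((PfPersistenceF5TailTwins.isWeilTest_translate hg _).const_mul _)

/-- Support of a comb: if `g` lives on `[-b, b]` and every tooth satisfies `|x_j| ≤ a - b`, the comb lives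
on `[-a, a]`. -/
theorem tsupport_comb_subset (hs : tsupport g ⊆ Icc (-b) b) :
    ∀ (m : ℕ) (x ε : Fin m → ℝ), (∀ j, |x j| ≤ a - b) → tsupport (comb m x ε g) ⊆ Icc (-a) a := by
  intro m
  induction m with
  | zero => intro x ε _; rw [comb_zero]; simp [tsupport_zero]
  | succ m ih =>
    intro x ε hx
    rw [comb_succ]
    refine tsupport_add_mul_subset isClosed_Icc (ih _ _ fun j ↦ hx _) ?_ _
    have hl := hx (Fin.last m)
    rw [abs_le] at hl
    exact (PfPersistenceF5TailTwins.tsupport_translate_subset hs _).trans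
      (Icc_subset_Icc (by linarith) (by linarith))

/-! ## §3 The PSD bound for a comb -/

/-- **F5-COMB, PSD half.** On a Weil-positive window `[-a, a]`, a signed comb of `m` translates of `g`
(`|ε_j| ≤ 1`, `|x_j| ≤ a - b`, `g` supported in `[-b, b]`, `b ≤ a`) has
`Re Q_ζ(comb) ≤ (2^{m+1} − 2)·E` whenever `Re Q_ζ(g) ≤ E`
(induction on `m` with the PSD parallelogram inequality and `Q(τ_x g) = Q(g)`). [folklore] -/
theorem re_weilQuadratic_comb_le (hg : IsWeilTest g) (hs : tsupport g ⊆ Icc (-b) b) (hba : b ≤ a)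
    (hW : WeilPositivityOn a) {E : ℝ} (hq : (weilQuadratic g).re ≤ E) :
    ∀ (m : ℕ) (x ε : Fin m → ℝ), (∀ j, |x j| ≤ a - b) → (∀ j, (ε j) ^ 2 ≤ 1) →
      (weilQuadratic (comb m x ε g)).re ≤ (2 ^ (m + 1) - 2) * E := by
  have hQg : 0 ≤ (weilQuadratic g).re :=
    hW g hg (hs.trans (Icc_subset_Icc (by linarith) (by linarith)))
  have hE : 0 ≤ E := hQg.trans hq
  intro m
  induction m with
  | zero =>
    intro x ε _ _
    rw [comb_zero, weilQuadratic_zero]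
    simp
  | succ m ih =>
    intro x ε hx hε
    rw [comb_succ]
    set u := comb m (fun j ↦ x (Fin.castSucc j)) (fun j ↦ ε (Fin.castSucc j)) g with hu_def
    set v := PfPersistenceF5TailTwins.translate (x (Fin.last m)) g with hv_def
    have hu : IsWeilTest u := isWeilTest_comb hg _ _ _
    have hv : IsWeilTest v := PfPersistenceF5TailTwins.isWeilTest_translate hg _
    have hus : tsupport u ⊆ Icc (-a) a := tsupport_comb_subset hs _ _ _ fun j ↦ hx _
    have hl := hx (Fin.last m)
    rw [abs_le] at hl
    have hvs : tsupport v ⊆ Icc (-a) a :=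
      (PfPersistenceF5TailTwins.tsupport_translate_subset hs _).trans
        (Icc_subset_Icc (by linarith) (by linarith))
    have hstep := re_weilQuadratic_add_real_mul_le hu hv hus hvs hW (ε (Fin.last m))
    have hQv : (weilQuadratic v).re = (weilQuadratic g).re := by
      rw [hv_def, PfPersistenceF5TailTwins.weilQuadratic_translate]
    have hih := ih (fun j ↦ x (Fin.castSucc j)) (fun j ↦ ε (Fin.castSucc j)) (fun j ↦ hx _)
      (fun j ↦ hε _)
    have hεl := hε (Fin.last m)
    have h1 : ε (Fin.last m) ^ 2 * (weilQuadratic g).re ≤ E :=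
      (mul_le_of_le_one_left hQg hεl).trans hq
    rw [hQv] at hstep
    have hpow : (2 : ℝ) ^ (m + 1 + 1) = 2 * 2 ^ (m + 1) := by ring
    rw [hpow]
    nlinarith [hstep, hih, h1, hE]

/-- **F5-COMB, PSD half, Rayleigh form.** With `E = ε‖g‖₂²`: on a Weil-positive window a signed comb of
`m` translates has `Re Q_ζ(comb) ≤ (2^{m+1} − 2)·ε‖g‖₂²`. [folklore] -/
theorem re_weilQuadratic_comb_le_rayleigh (hg : IsWeilTest g) (hs : tsupport g ⊆ Icc (-b) b)
    (hba : b ≤ a) (hW : WeilPositivityOn a) {ε : ℝ}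
    (hq : (weilQuadratic g).re ≤ ε * ∫ x, ‖g x‖ ^ 2) (m : ℕ) (x sgn : Fin m → ℝ)
    (hx : ∀ j, |x j| ≤ a - b) (hsgn : ∀ j, (sgn j) ^ 2 ≤ 1) :
    (weilQuadratic (comb m x sgn g)).re ≤ (2 ^ (m + 1) - 2) * (ε * ∫ x, ‖g x‖ ^ 2) :=
  re_weilQuadratic_comb_le hg hs hba hW hq m x sgn hx hsgn

/-- **Contrapositive (the form the campaign uses).** If some signed comb of `m` translates of `g`
(teeth inside `[-(a-b), a-b]`, `|ε_j| ≤ 1`) has `Re Q_ζ(comb) > (2^{m+1} − 2)·ε‖g‖₂²` while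
`Re Q_ζ(g) ≤ ε‖g‖₂²`, then `ζ` is NOT Weil-positive on `[-a, a]`. [folklore] -/
theorem not_weilPositivityOn_of_comb (hg : IsWeilTest g) (hs : tsupport g ⊆ Icc (-b) b)
    (hba : b ≤ a) {ε : ℝ} (hq : (weilQuadratic g).re ≤ ε * ∫ x, ‖g x‖ ^ 2) (m : ℕ)
    (x sgn : Fin m → ℝ) (hx : ∀ j, |x j| ≤ a - b) (hsgn : ∀ j, (sgn j) ^ 2 ≤ 1)
    (hbig : (2 ^ (m + 1) - 2) * (ε * ∫ x, ‖g x‖ ^ 2) < (weilQuadratic (comb m x sgn g)).re) :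
    ¬ WeilPositivityOn a := fun hW ↦
  not_lt.mpr (re_weilQuadratic_comb_le_rayleigh hg hs hba hW hq m x sgn hx hsgn) hbig

end Summit.RiemannHypothesis.RiemannHypothesis.Theorems.PfPersistenceF5CombPSD

end
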